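import Literature.NumberTheory.DiophantineApproximation.PolylogRigidityNearZero
import Literature.NumberTheory.DiophantineApproximation.PolylogLinearIndependence
import Literature.NumberTheory.Transcendental.CalegariDimitrovTangL2Chi3Period
import Mathlib.MeasureTheory.Integral.Pi
import Mathlib.MeasureTheory.Integral.DominatedConvergence
import Mathlib.Analysis.SpecificLimits.Basic
import Mathlib.Analysis.SpecialFunctions.Integrals.Basic
import Mathlib.Analysis.Complex.ExponentialBounds
import HarnessLib

/-!
# Linear independence of `1/(N−1), Li₁(1/N), …, Li_w(1/N)` in cube-integral form — proof of the named fact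

Topic `Literature/NumberTheory/DiophantineApproximation`; proofs-only companion of `PolylogRigidityNearZero.lean`
(no new definition, no new named fact). The named fact `PolylogRigidityNearZero` (Nikišin 1979; David–Hirata-Kohno–
Kawashima 2020, Thm 2.1 at `x = 0`, `m = 1`, `K = ℚ`, with an unspecified threshold) asks: for every `w` there is
`N₀` such that for all integers `N ≥ N₀` every rational relation
`Σ_{i ≤ w} βᵢ · ∫_{[0,1]^i} dp/(N − p₀⋯p_{i−1}) = 0` is trivial.  As announced in the statement file's docstring,
the discharge is the tree's PROVED series form
`Literature.NumberTheory.DiophantineApproximation.one_polylog_linearIndependent` (`1, Li₁(1/N), …, Li_w(1/N)`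
over `ℚ` for `log N ≥ (w+1)³`) plus the identification of the cube integrals with the series:

* `integral_cube_eq_polylogSeries` — for every dimension `i` and every integer `N ≥ 2`,
  `∫_{[0,1]^i} dp/(N − ∏_l p_l) = Σ_{k≥0} N^{−(k+1)}/(k+1)^i = DilogPade.polylogSeries i (1/N)` (geometric
  expansion `1/(N − u) = Σ_k u^k/N^{k+1}`, `u = ∏ p_l ∈ [0,1]`, termwise integration by
  `MeasureTheory.integral_tsum_of_summable_integral_norm`, and Fubini on the `i`-cube,
  `∫_{[0,1]^i} (∏ p_l)^k = (1/(k+1))^i`; the case `i = 0` is the one-point cube, both sides `= 1/(N−1)`);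
* `polylogSeries_zero_level` — `Li₀(1/N) = Σ_{k≥1} N^{−k} = 1/(N−1)`;
* **`PolylogRigidityNearZero_holds`** — with `N₀ = 3^{(w+1)³}` for `w ≥ 1` (so that `log N ≥ (w+1)³`, as
  `log 3 ≥ 1`) and `N₀ = 2` for `w = 0` (where the single value `1/(N−1) ≠ 0`).

The same identification is a theorem of the summit tree (`Summits/KontsevichZagierPeriods/KontsevichZagierPeriods/
Theorems/HermiteRigidityDilogRigidityCubeSeriesLevel.lean`, `stub_cubeIntegralSeriesLevel`, and `stub_polylogRigidity`
in `…/HermiteRigidityPolylogRigidity.lean`), which Literature cannot import; the proofs below are adapted from those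
files into this directory's vocabulary (`KZ.cube`, `DilogPade.polylogSeries`).

## References
* E. M. Nikišin, *On irrationality of the values of the functions F(x,s)*, Mat. Sb. 109(151) (1979) 410–417.
  [Nikishin1979]
* S. David, N. Hirata-Kohno, M. Kawashima, *Can polylogarithms at algebraic points be linearly independent?*,
  Moscow J. Comb. Number Theory 9 (2020) 389–406, Thm 2.1. [DavidHirataKohnoKawashima2020]
-/

noncomputable section

open MeasureTheory Set

namespace Literature.NumberTheory.DiophantineApproximation

open Literature.NumberTheory.Transcendental
open Literature.NumberTheory.Transcendental.KZ

/-! ### Termwise integrals over the cube -/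

-- adapted from Summits/KontsevichZagierPeriods/KontsevichZagierPeriods/Theorems/
--   HermiteRigidityDilogRigidityCubeSeriesLevel.lean (integral_cube_prod_pow, stub_cubeIntegralSeriesLevel)

/-- Fubini on the `i`-cube: `∫_{[0,1]^i} (∏_l p_l)^k dp = (∫₀¹ x^k dx)^i = (1/(k+1))^i` (including `i = 0`,
where both sides are `1`). [folklore] -/
private theorem integral_cube_prod_pow' (i k : ℕ) :
    ∫ p in cube i, (∏ l, p l) ^ k = (1 / ((k : ℝ) + 1)) ^ i := by
  have h1 : ∀ p : Fin i → ℝ, (∏ l, p l) ^ k = ∏ l : Fin i, (p l) ^ k := fun p =>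
    (Finset.prod_pow Finset.univ k p).symm
  simp_rw [h1]
  rw [cube_eq_pi, volume_pi, Measure.restrict_pi_pi]
  have h := integral_fintype_prod_eq_pow (ι := Fin i) (fun x : ℝ => x ^ k)
    (μ := volume.restrict (Icc (0 : ℝ) 1))
  rw [Fintype.card_fin] at h
  rw [h, CalegariDimitrovTang.setIntegral_Icc_pow]

/-- On the cube the product of the coordinates lies in `[0, 1]`. [folklore] -/
private theorem prod_mem_unitInterval {i : ℕ} {p : Fin i → ℝ} (hp : p ∈ cube i) :
    0 ≤ ∏ l, p l ∧ ∏ l, p l ≤ 1 :=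
  ⟨Finset.prod_nonneg fun l _ => (hp l).1,
    Finset.prod_le_one (fun l _ => (hp l).1) fun l _ => (hp l).2⟩

/-! ### The cube integrals are the polylogarithm series -/

/-- **The weight-`i` cube integral as a polylogarithm value**: for every dimension `i` and every integer `N ≥ 2`,
`∫_{[0,1]^i} dp/(N − ∏_l p_l) = Σ_{k≥0} (1/N)^{k+1}/(k+1)^i = Li_i(1/N)` ("expanding the geometric series and
integrating termwise, `I_0(N) = 1/(N−1)` and `I_i(N) = Li_i(1/N)` for `i ≥ 1`" — the identification under
which [DavidHirataKohnoKawashima2020, Thm 2.1] is the typed cube-integral statement).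
[cite: DavidHirataKohnoKawashima2020, Thm 2.1 (the values Li_s(1/N), cube-integral form)] -/
theorem integral_cube_eq_polylogSeries (i : ℕ) {N : ℕ} (hN : 2 ≤ N) :
    ∫ p in cube i, 1 / ((N : ℝ) - ∏ l, p l) = DilogPade.polylogSeries i (1 / (N : ℝ)) := by
  have hν : (2 : ℝ) ≤ N := by exact_mod_cast hN
  have hνpos : (0 : ℝ) < N := by linarith
  rw [DilogPade.polylogSeries]
  -- the terms of the expansion
  set F : ℕ → (Fin i → ℝ) → ℝ := fun k p => (1 / (N : ℝ)) ^ (k + 1) * (∏ l, p l) ^ k with hF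
  -- pointwise geometric expansion on the cube
  have hexp : EqOn (fun p : Fin i → ℝ => 1 / ((N : ℝ) - ∏ l, p l)) (fun p => ∑' k, F k p) (cube i) := by
    intro p hp
    obtain ⟨h0, h1⟩ := prod_mem_unitInterval hp
    have hr0 : 0 ≤ (∏ l, p l) / (N : ℝ) := div_nonneg h0 hνpos.le
    have hr1 : (∏ l, p l) / (N : ℝ) < 1 := by
      rw [div_lt_one hνpos]; linarith
    have hgeom := (hasSum_geometric_of_lt_one hr0 hr1).mul_left (1 / (N : ℝ))
    have hval : 1 / (N : ℝ) * (1 - (∏ l, p l) / N)⁻¹ = 1 / ((N : ℝ) - ∏ l, p l) := by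
      have hne : (N : ℝ) - ∏ l, p l ≠ 0 := by linarith
      field_simp
    have hterm : (fun k : ℕ => 1 / (N : ℝ) * ((∏ l, p l) / N) ^ k) = fun k => F k p := by
      funext k
      simp only [hF]
      ring
    rw [hval, hterm] at hgeom
    exact hgeom.tsum_eq.symm
  -- each term is integrable on the cube
  have hint : ∀ k, Integrable (F k) (volume.restrict (cube i)) := by
    intro k
    have hc : Continuous (F k) := by
      simp only [hF]
      fun_prop
    exact hc.continuousOn.integrableOn_compact isCompact_cube
  -- the value of each termwise integral
  have hval : ∀ k, ∫ p in cube i, F k p = (1 / (N : ℝ)) ^ (k + 1) / ((k : ℝ) + 1) ^ i := by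
    intro k
    simp only [hF]
    rw [integral_const_mul, integral_cube_prod_pow']
    ring
  -- the norms: `‖F k p‖ = F k p` on the cube
  have hnorm : ∀ k, ∫ p in cube i, ‖F k p‖ = (1 / (N : ℝ)) ^ (k + 1) / ((k : ℝ) + 1) ^ i := by
    intro k
    rw [← hval k]
    refine setIntegral_congr_fun measurableSet_cube fun p hp => ?_
    simp only [hF]
    exact Real.norm_of_nonneg
      (mul_nonneg (pow_nonneg (by positivity) _) (pow_nonneg (prod_mem_unitInterval hp).1 _))
  -- summability of the norms: dominated by the geometric series `Σ (1/N)^(k+1)`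
  have hsum : Summable fun k => ∫ p in cube i, ‖F k p‖ := by
    simp_rw [hnorm]
    have hq0 : 0 ≤ 1 / (N : ℝ) := by positivity
    have hq1 : 1 / (N : ℝ) < 1 := by rw [div_lt_one hνpos]; linarith
    have hg : Summable fun k : ℕ => 1 / (N : ℝ) * (1 / (N : ℝ)) ^ k :=
      (summable_geometric_of_lt_one hq0 hq1).mul_left _
    refine Summable.of_nonneg_of_le (fun k => by positivity) (fun k => ?_) hg
    rw [← pow_succ']
    have hk : (1 : ℝ) ≤ ((k : ℝ) + 1) ^ i :=
      one_le_pow₀ (by linarith [(k.cast_nonneg : (0 : ℝ) ≤ k)])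
    exact div_le_self (pow_nonneg hq0 (k + 1)) hk
  -- termwise integration
  rw [setIntegral_congr_fun measurableSet_cube hexp, ← integral_tsum_of_summable_integral_norm hint hsum]
  exact tsum_congr hval

/-- The weight-zero value: `Li₀(1/N) = Σ_{k≥1} N^{−k} = 1/(N−1)` for `N ≥ 2` (so the one-point cube integral
`I_0(N) = 1/(N−1)` is the `i = 0` member of the same series family). [folklore] -/
private theorem polylogSeries_zero_level {N : ℕ} (hN : 2 ≤ N) :
    DilogPade.polylogSeries 0 (1 / (N : ℝ)) = ((N : ℝ) - 1)⁻¹ := by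
  have hN' : (2 : ℝ) ≤ N := by exact_mod_cast hN
  have hx0 : (0 : ℝ) ≤ 1 / N := by positivity
  have hx1 : 1 / (N : ℝ) < 1 := by rw [div_lt_one (by linarith)]; linarith
  rw [DilogPade.polylogSeries]
  simp only [pow_zero, div_one, pow_succ]
  rw [tsum_mul_right, tsum_geometric_of_lt_one hx0 hx1]
  have : (N : ℝ) - 1 ≠ 0 := by linarith
  field_simp

/-- `N ≥ 3^{(w+1)³}` gives `log N ≥ (w+1)³` (since `log 3 ≥ 1`). [folklore] -/
private theorem log_ge_of_three_pow_le' {w N : ℕ} (hN : 3 ^ ((w + 1) ^ 3) ≤ N) :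
    ((w : ℝ) + 1) ^ 3 ≤ Real.log (N : ℝ) := by
  have h3 : (1 : ℝ) ≤ Real.log 3 := by
    rw [Real.le_log_iff_exp_le (by norm_num)]
    have := Real.exp_one_lt_d9
    linarith
  have hpos : (0 : ℝ) < (3 : ℝ) ^ ((w + 1) ^ 3) := by positivity
  have hN' : ((3 : ℝ) ^ ((w + 1) ^ 3)) ≤ N := by exact_mod_cast hN
  have h1 := Real.log_le_log hpos hN'
  rw [Real.log_pow] at h1
  push_cast at h1
  calc ((w : ℝ) + 1) ^ 3 = ((w : ℝ) + 1) ^ 3 * 1 := (mul_one _).symm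
    _ ≤ ((w : ℝ) + 1) ^ 3 * Real.log 3 := mul_le_mul_of_nonneg_left h3 (by positivity)
    _ ≤ Real.log N := h1

/-! ### The named fact -/

-- adapted from Summits/KontsevichZagierPeriods/KontsevichZagierPeriods/Theorems/
--   HermiteRigidityPolylogRigidity.lean (stub_polylogRigidity)

/-- **Rigidity near zero — the named fact `PolylogRigidityNearZero` HOLDS** (Nikišin 1979; David–Hirata-Kohno–
Kawashima 2020, Thm 2.1 at `x = 0`, `m = 1`, `K = ℚ`): for every `w` there is `N₀` (here `3^{(w+1)³}` for
`w ≥ 1`, `2` for `w = 0`) such that for all integers `N ≥ N₀` every rational relation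
`Σ_{i ≤ w} βᵢ · ∫_{[0,1]^i} dp/(N − ∏ p_l) = 0` is trivial — the cube integrals are `1/(N−1), Li₁(1/N), …,
Li_w(1/N)` (`integral_cube_eq_polylogSeries`) and the tree's `one_polylog_linearIndependent` (log N ≥ (w+1)³)
concludes. [cite: DavidHirataKohnoKawashima2020, Thm 2.1] -/
theorem PolylogRigidityNearZero_holds : PolylogRigidityNearZero := by
  intro w
  rcases Nat.eq_zero_or_pos w with rfl | hw
  · -- `w = 0`: the single value `∫_{[0,1]⁰} = 1/(N−1) ≠ 0`
    refine ⟨2, fun N hN β hβ => ?_⟩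
    intro i hi
    have hi0 : i = 0 := by have := Finset.mem_range.1 hi; omega
    subst hi0
    rw [zero_add, Finset.sum_range_one, integral_cube_eq_polylogSeries 0 hN,
      polylogSeries_zero_level hN] at hβ
    have hN' : (2 : ℝ) ≤ N := by exact_mod_cast hN
    have hne : ((N : ℝ) - 1)⁻¹ ≠ 0 := inv_ne_zero (by linarith)
    rcases mul_eq_zero.1 hβ with h | h
    · exact_mod_cast h
    · exact absurd h hne
  · refine ⟨3 ^ ((w + 1) ^ 3), fun N hN β hβ => ?_⟩
    have hlog := log_ge_of_three_pow_le' hN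
    have hN2 : 2 ≤ N := by
      have h1 : 1 ≤ (w + 1) ^ 3 := Nat.one_le_pow _ _ (by omega)
      calc 2 ≤ 3 ^ 1 := by norm_num
        _ ≤ 3 ^ ((w + 1) ^ 3) := Nat.pow_le_pow_right (by norm_num) h1
        _ ≤ N := hN
    have hNr : (2 : ℝ) ≤ N := by exact_mod_cast hN2
    have hN1q : (N : ℚ) - 1 ≠ 0 := by
      have : (2 : ℚ) ≤ N := by exact_mod_cast hN2
      linarith
    -- the integrals are the series
    have hL : ∀ i, (∫ p in cube i, 1 / ((N : ℝ) - ∏ l, p l)) = DilogPade.polylogSeries i (1 / (N : ℝ)) :=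
      fun i => integral_cube_eq_polylogSeries i hN2
    simp only [hL] at hβ
    -- split off `i = 0` and pass to `Fin`-indexed rational coefficients
    rw [Finset.sum_range_succ', polylogSeries_zero_level hN2] at hβ
    set a : Fin (w + 1) → ℚ := Fin.cases (β 0 / ((N : ℚ) - 1)) (fun j => β ((j : ℕ) + 1)) with ha
    have hrel : (a 0 : ℝ) + ∑ j : Fin w, (a j.succ : ℝ) *
        DilogPade.polylogSeries ((j : ℕ) + 1) (1 / (N : ℝ)) = 0 := by
      simp only [ha, Fin.cases_zero, Fin.cases_succ]
      rw [← Finset.sum_range (fun i => (β (i + 1) : ℝ) * DilogPade.polylogSeries (i + 1) (1 / (N : ℝ)))]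
      push_cast
      linear_combination hβ
    have h0 := one_polylog_linearIndependent w hw N hlog a hrel
    intro i hi
    have hi' : i < w + 1 := Finset.mem_range.1 hi
    rcases i with _ | i
    · have : a 0 = 0 := by rw [h0]; rfl
      simp only [ha, Fin.cases_zero] at this
      rcases (div_eq_zero_iff).1 this with h | h
      · exact h
      · exact absurd h hN1q
    · have : a ⟨i + 1, hi'⟩ = 0 := by rw [h0]; rfl
      have e : (⟨i + 1, hi'⟩ : Fin (w + 1)) = Fin.succ ⟨i, by omega⟩ := rfl
      rw [e] at this
      simpa [ha] using this

end Literature.NumberTheory.DiophantineApproximation
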